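import Literature.Barriers.ValiantsHypothesis.BDGIL24GelfandTsetlinProjectorLength
import Literature.Barriers.ValiantsHypothesis.BDGIL24IteratedLeibniz
import Literature.Barriers.ValiantsHypothesis.BDGIL24WeightProjectionProofs
import Literature.Computability.AlgebraicComplexity.ArithCircuitChain
import HarnessLib

/-!
# [BDGIL24, Thm. 5.10] AS PRINTED: circuit transformations — an element `P ∈ U(gl_k)` of LENGTH `L`
# maps a metapolynomial with a circuit of size `s` to one with a circuit of size `O(s · L^{2k²})`
# — PROVED (`BergEtAl2024.thm_5_10`, `BergEtAl2024.thm_5_10_oneBlock`)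

[BDGIL24] = M. van den Berg, P. Dutta, F. Gesmundo, C. Ikenmeyer, V. Lysikov, *Algebraic
metacomplexity and representation theory*, arXiv:2411.03444, §5.2 "Circuit transformations"
(p.28–29, PDF p.29–30; held text paper:arxiv-2411.03444 p0029.txt:L27–L80, p0030.txt:L1–L40):

> **Theorem 5.10.** Let `P ∈ U(gl_k)` be an element of length `L`. Suppose there exists an
> arithmetic circuit `C` of size `s` computing a metapolynomial `Δ : ℂ[x₁,…,x_k]_d → ℂ`. Then there
> exists an arithmetic circuit `C′` of size `O(s L^{2k²})` computing `P.Δ`.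
> *Proof.* Set `K := k²`. Construct `C′` from `C` …: 1. Add for every input gate `Θ` in `C` the
> input gates `X^i.Θ` for `i ∈ ℕ^K_{≤L}`. 2. Add for every addition gate `Θ = Φ + Γ` the addition
> gates computing `X^i.Θ` … using Lemma 5.9. 3. Add for every product gate `Θ = ΦΓ`: product gates
> computing `(X^{i′}.Φ)(X^{i−i′}.Γ)` for `i ∈ ℕ^K_{≤L}` and `i′ ≤ i`, addition gates computing
> `X^i.Θ` … using Lemma 5.9. 4. The resulting circuit computes `X^i.Δ` for `i ∈ ℕ^K_{≤L}`. By the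
> PBW theorem there exist scalars `β_i` such that `P = Σ_{i ∈ ℕ^K_{≤L}} β_i X^i`. Add to `C′` the
> addition gates computing `P.Δ`. The largest blow-up occurs in step 3 … `2|A| − 1`,
> `|A| = binom(L+2K, 2K)` … `O(L^{2K})`.

The printed statement was recorded as NOT typed (`BDGIL24EnvelopingActionCost.lean`: "the
printed `L`-sensitive bound remains untyped"; that file holds the tree-native, length-free bound
`cc(P.Δ) ≤ (δd+1)^{k²−1}(s+2)` for homogeneous `Δ` via the orbit span). Here the printed statement
is typed and proved along the printed proof.

## What is typed and proved

* `monOp D i` — the ordered monomial `X^i = X₁^{i₁}⋯X_K^{i_K}` in a family of derivations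
  (`= lemma_5_9`'s operator; Leibniz rule `monOp_mul` = Lemma 5.9 (2), `monOp_algebraMap`), and
  `ordMonomial_eq_prod_ofFn_pow`: it IS the tree's PBW ordered monomial (`PBW.ordMonomial`) under
  any representation — so "length `≤ L`" (`PBW.fil`, [BDGIL24, §4.3]) means `P = Σ_{|i|≤L} β_i X^i`
  (`PBW.mem_fil_iff_repr`, Thm. 4.9);
* the gate-by-gate table of the printed proof, on the tree's fan-in-two `ArithCircuit`s
  (`Literature.Computability.AlgebraicComplexity`): `stepVal` (steps 1–3: `X^i` of an input /
  addition / product gate in terms of the `X^{i′}` of its operands, `stepVal_truth` = Lemma 5.9),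
  `synOpnd` / `stepPoly` / `finalPoly` (the new circuit as a chain of substitutions, the inputs
  `X^i.ℓ` of the affine input gates `ℓ` being NEW affine input gates), `chainVal` +
  `complexity_aeval_chainVal_le` (one circuit computes the whole table: the tree's sharing bound
  `complexity_chain_le`, Bürgisser Rem. 2.7, extended by a final step), `aeval_chainVal_stepPoly`
  (step 4: "The resulting circuit computes `X^i.Δ`"), `complexity_stepVal_synOpnd_le` (cost `≤ 3(L+1)^K`
  per table entry);
* **`affComplexity_sum_smul_le_of_leibniz`** / **`affComplexity_sum_smul_monOp_le`** — the abstract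
  Thm. 5.10: for any Leibniz family `X^•` of linear operators on `ℂ[c]` preserving affine forms,
  `cc(Σ_{i ∈ {0..L}^K} β_i X^i.Δ) ≤ 5 (L+1)^{2K} · cc(Δ)`;
* **`thm_5_10`** — for `P ∈ fil (stdB T k) L ⊂ U(T → gl_k)` (length `≤ L`) acting on metapolynomials
  through the block `τ₀` (`envActGL`, as in the Cor. 5.5–5.8 files) and ANY `Δ ∈ ℂ[ℂ[x₁,…,x_k]_d]`:
  `cc(P.Δ) ≤ 5 (L+1)^{2K} · cc(Δ)`, `K = |T|·k²`; **`thm_5_10_oneBlock`** (`|T| = 1`, i.e. `U(gl_k)`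
  verbatim): `cc(P.Δ) ≤ 5 (L+1)^{2k²} · cc(Δ) = O(s · L^{2k²})`;
* **`thm_1_1_proof_weight` / `_isotypic` / `_hwv` / `_gt`** (§8) — the printed "Proof of Theorem 1.1"
  (end of §5.2), items 1–4: the length bounds of Cor. 5.5 / 5.6 / 5.7 / 5.8 (`cor_5_5_length`,
  `cor_5_6_length`, `cor_5_7_length`, `cor_5_8_length`) fed into Thm. 5.10 give the projectors
  `H_μ, Z_λ, X_λ, Y_T ∈ U(gl_k)` with `cc(H_μ.Δ) ≤ 5((δd+1)^k + 1)^{2K} cc(Δ)`,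
  `cc(Z_λ.Δ) ≤ 5(k(δd+1)^k + 1)^{2k²} cc(Δ)`, `cc(X_λ.Δ) ≤ 5((k+1)(δd+1)^k + 1)^{2k²} cc(Δ)`,
  `cc(Y_T.Δ) ≤ 5(k(δd+1)^{k²} + 1)^{2k²} cc(Δ)` — the printed `O(s(δd)^{2k³})`, `O(s k^{2k²}(δd)^{2k³})`,
  `O(s(k+1)^{2k²}(δd)^{2k³})`, `O(s k^{2k²}(δd)^{2k⁴})` (the tree's `thm_1_1_weight/_isotypic/_hwv/_gt_holds`
  keep the sharper orbit-span constants; this is the printed route).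

Deviations (disclosed): (i) the size measure is `cc = affComplexity` (circuits with affine-linear
input gates, [BDGIL24, §2.1]) as in all BDGIL24 files of the tree; (ii) the table is indexed by the
box `{0,…,L}^K ⊇ ℕ^K_{≤L}` and each entry is charged `3·#{i′ ≤ i}` gates (product, scalar, sum)
instead of the printed `2|A| − 1` per gate with `|A| = binom(L+2K,2K)`: constant `5 (L+1)^{2K}` in
place of an unspecified `O(L^{2K})` — the same printed `O(s · L^{2k²})`; (iii) the block model
`U(T → gl_k)` of the tree (`K = |T| k²`), one block being the printed case.

Honest framing: circuit bookkeeping; nothing here bears on `VP ≠ VNP`, which is NOT proved.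

## References
* [BergEtAl2024] arXiv:2411.03444, §5.2: Lemma 5.9, Thm. 5.10, Proof of Theorem 1.1 (p.28–30,
  PDF p.29–31); §4.3
  (length, Thm. 4.9 PBW, p.19); §2.1 (`cc`, p.6); Cor. 5.5–5.8 (p.27–28).
* [Burgisser2000] P. Bürgisser, *Completeness and Reduction in Algebraic Complexity Theory*,
  Def. 2.1, Rem. 2.7 (the circuit model and the sharing bound, tree `complexity_chain_le`).
-/

noncomputable section

-- Mathlib idiom: the commutator bracket on an associative algebra (`T → Matrix (Fin k) (Fin k) ℂ`),
-- as in the imported `BDGIL24CentralCharacters` / `HarishChandraCore`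
attribute [local instance 100] LieRing.ofAssociativeRing

open MvPolynomial
open scoped BigOperators

namespace Literature.Barriers.ValiantsHypothesis

namespace BergEtAl2024

open Finset (Iic)

/-! ### §1 The ordered monomials `X^i = X₁^{i₁} ⋯ X_K^{i_K}` in a family of operators -/

section MonOp

variable {R A : Type*} [CommRing R] [CommRing A] [Algebra R A] {K : ℕ}

/-- **The ordered monomial `X^i := X₁^{i₁} ⋯ X_K^{i_K}`** of [BDGIL24, §5.2] in a family of
derivations `D₀, …, D_{K−1}` (the paper's ordered basis `(X₁,…,X_{k²})` of `gl_k` acting by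
derivations, Claim 4.2), as an endomorphism: `D₀^{i₀} ∘ ⋯ ∘ D_{K−1}^{i_{K−1}}` — the operator of
`lemma_5_9`. [cite: BergEtAl2024, §5.2, p.28 (PDF p.29)] locator: paper:arxiv-2411.03444 p0029.txt:L31–L35 -/
def monOp (D : Fin K → Derivation R A A) (i : Fin K → ℕ) : Module.End R A :=
  (List.ofFn fun r => (D r : Module.End R A) ^ i r).prod

/-- `X^0 = 1`. [cite: BergEtAl2024, §5.2, p.28 (PDF p.29)] -/
theorem monOp_zero (D : Fin K → Derivation R A A) : monOp D 0 = 1 := by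
  unfold monOp
  exact List.prod_eq_one fun x hx => by
    obtain ⟨r, rfl⟩ := (List.mem_ofFn' _ _).1 hx
    exact pow_zero _

/-- **Lemma 5.9 (2) for `monOp`**: `X^i (ab) = Σ_{j ≤ i} (∏_r binom(i_r, j_r)) (X^j a)(X^{i−j} b)`
(`lemma_5_9`). [cite: BergEtAl2024, Lemma 5.9 (2), p.28 (PDF p.29)] -/
theorem monOp_mul (D : Fin K → Derivation R A A) (i : Fin K → ℕ) (a b : A) :
    monOp D i (a * b) =
      ∑ j ∈ Iic i, (∏ r, (i r).choose (j r)) • (monOp D j a * monOp D (i - j) b) :=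
  lemma_5_9 D i a b

/-- Powers of a derivation kill the constants: `D^n (algebraMap c) = 0` for `n ≠ 0`, and `= algebraMap c`
for `n = 0`. [folklore] -/
private theorem derivation_pow_apply_algebraMap (D : Derivation R A A) (n : ℕ) (c : R) :
    ((D : Module.End R A) ^ n) (algebraMap R A c) = if n = 0 then algebraMap R A c else 0 := by
  cases n with
  | zero => rw [pow_zero, Module.End.one_apply, if_pos rfl]
  | succ n =>
    rw [if_neg (Nat.succ_ne_zero n), pow_succ, Module.End.mul_apply]
    change ((D : Module.End R A) ^ n) (D (algebraMap R A c)) = 0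
    rw [Derivation.map_algebraMap, map_zero]

/-- `X^i` on constants: `X^i (algebraMap c) = algebraMap c` if `i = 0` and `0` otherwise.
[cite: BergEtAl2024, §5.2, p.28 (PDF p.29)] -/
theorem monOp_algebraMap (D : Fin K → Derivation R A A) (i : Fin K → ℕ) (c : R) :
    monOp D i (algebraMap R A c) = if i = 0 then algebraMap R A c else 0 := by
  induction K with
  | zero =>
    rw [Subsingleton.elim i 0, monOp_zero, Module.End.one_apply, if_pos rfl]
  | succ K ih =>
    unfold monOp
    rw [List.ofFn_succ, List.prod_cons, Module.End.mul_apply]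
    have h := ih (fun r => D r.succ) (fun r => i r.succ)
    unfold monOp at h
    rw [h]
    by_cases htail : (fun r : Fin K => i r.succ) = 0
    · rw [if_pos htail, derivation_pow_apply_algebraMap]
      by_cases h0 : i 0 = 0
      · have hi : i = 0 := by
          funext r
          refine Fin.cases h0 (fun r' => ?_) r
          exact congr_fun htail r'
        rw [if_pos h0, if_pos hi]
      · have hi : i ≠ 0 := fun hi => h0 (by rw [hi, Pi.zero_apply])
        rw [if_neg h0, if_neg hi]
    · have hi : i ≠ 0 := fun hi => htail (by funext r; rw [hi, Pi.zero_apply, Pi.zero_apply])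
      rw [if_neg htail, map_zero, if_neg hi]

/-- `X^i` is `R`-linear (it is an endomorphism; [BDGIL24, Lemma 5.9 (1)]): sums.
[cite: BergEtAl2024, Lemma 5.9 (1), p.28 (PDF p.29)] -/
theorem monOp_add (D : Fin K → Derivation R A A) (i : Fin K → ℕ) (a b : A) :
    monOp D i (a + b) = monOp D i a + monOp D i b :=
  map_add _ a b

end MonOp

/-! ### §1b Ordered products `∏_r x_r^{t_r}` and the PBW ordered monomials -/

section OrderedPowers

variable {M : Type*} [Monoid M]

/-- Splitting off the least letter of an ordered power product: if `t_r = 0` for `r < j` then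
`∏_r x_r^{t_r + [r = j]} = x_j · ∏_r x_r^{t_r}` (ordered products, noncommutative). [folklore] -/
private theorem prod_ofFn_pow_add_indicator {K : ℕ} (x : Fin K → M) (t : Fin K → ℕ) (j : Fin K)
    (ht : ∀ r, r < j → t r = 0) :
    (List.ofFn fun r => x r ^ (t r + if r = j then 1 else 0)).prod =
      x j * (List.ofFn fun r => x r ^ t r).prod := by
  induction K with
  | zero => exact j.elim0
  | succ K ih =>
    simp only [List.ofFn_succ, List.prod_cons]
    revert ht
    refine Fin.cases ?_ (fun j' => ?_) j <;> intro ht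
    · have htl : (fun r : Fin K => x r.succ ^ (t r.succ + if r.succ = (0 : Fin (K + 1)) then 1 else 0)) =
          fun r => x r.succ ^ t r.succ :=
        funext fun r => by rw [if_neg (Fin.succ_ne_zero r), add_zero]
      rw [htl, if_pos rfl, pow_succ', mul_assoc]
    · have h0 : t 0 = 0 := ht 0 (Fin.succ_pos j')
      have htl : (fun r : Fin K => x r.succ ^ (t r.succ + if r.succ = j'.succ then 1 else 0)) =
          fun r => x r.succ ^ (t r.succ + if r = j' then 1 else 0) :=
        funext fun r => by simp only [Fin.succ_inj]
      rw [htl, ih (fun r => x r.succ) (fun r => t r.succ) j'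
          (fun r hr => ht r.succ (Fin.succ_lt_succ_iff.2 hr)),
        if_neg (Fin.succ_ne_zero j').symm, add_zero, h0, pow_zero, one_mul, one_mul]

/-- All exponents zero: the ordered power product is `1`. [folklore] -/
private theorem prod_ofFn_pow_zero {K : ℕ} (x : Fin K → M) :
    (List.ofFn fun r => x r ^ (0 : Fin K → ℕ) r).prod = 1 :=
  List.prod_eq_one fun y hy => by
    obtain ⟨r, rfl⟩ := (List.mem_ofFn' _ _).1 hy
    exact pow_zero _

end OrderedPowers

section PBWBridge

open Literature.Algebra.Lie.PBW UniversalEnvelopingAlgebra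

variable {R L : Type*} [CommRing R] [LieRing L] [LieAlgebra R L] {K : ℕ}

/-- **The PBW ordered monomial is the ordered power product**: for a basis indexed by `Fin K`,
`x_s = ι(x₀)^{s₀} ⋯ ι(x_{K−1})^{s_{K−1}}` — [BDGIL24]'s `X^i = X₁^{i₁}⋯X_K^{i_K}` (Thm. 4.9 / §5.2)
is the tree's `PBW.ordMonomial`. [cite: BergEtAl2024, Thm. 4.9 and §5.2, p.19 and p.28 (PDF p.20, p.29)] -/
theorem ordMonomial_eq_prod_ofFn_pow (b : Module.Basis (Fin K) R L) (s : Fin K →₀ ℕ) :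
    ordMonomial b s =
      (List.ofFn fun r => (ι R (b r) : UniversalEnvelopingAlgebra R L) ^ s r).prod := by
  induction s using induction_on_min with
  | h0 => rw [ordMonomial_zero, Finsupp.coe_zero, prod_ofFn_pow_zero]
  | hadd j t hjt ih =>
    rw [ordMonomial_single_add b hjt, ih]
    have hcoe : ((Finsupp.single j 1 + t : Fin K →₀ ℕ) : Fin K → ℕ) =
        fun r => t r + if r = j then 1 else 0 := by
      funext r
      rw [Finsupp.coe_add, Pi.add_apply, Finsupp.single_apply, add_comm]
      rcases eq_or_ne r j with h | h
      · rw [if_pos h.symm, if_pos h]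
      · rw [if_neg (Ne.symm h), if_neg h]
    rw [hcoe, prod_ofFn_pow_add_indicator _ _ j fun r hr => ?_]
    by_contra htr
    exact absurd (hjt r (Finsupp.mem_support_iff.2 htr)) (not_le.2 hr)

/-- The PBW filtration does not depend on the indexing of the basis: `fil (b.reindex e) n = fil b n`
(both are the span of all words of length `≤ n`, `fil_eq_span_word`). [cite: BergEtAl2024, §4.3, p.19 (PDF p.20)] -/
theorem fil_reindex {σ σ' : Type*} [LinearOrder σ] [LinearOrder σ'] (b : Module.Basis σ R L)
    (e : σ ≃ σ') (n : ℕ) : fil (b.reindex e) n = fil b n := by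
  have hword : ∀ l : List σ', word (b.reindex e) l = word b (l.map e.symm) := by
    intro l
    simp only [word, List.map_map]
    congr 1
    exact List.map_congr_left fun i _ => by rw [Function.comp_apply, Module.Basis.reindex_apply]
  rw [fil_eq_span_word, fil_eq_span_word]
  congr 1
  ext u
  constructor
  · rintro ⟨l, hl, rfl⟩
    exact ⟨l.map e.symm, by rwa [List.length_map], (hword l).symm⟩
  · rintro ⟨l, hl, rfl⟩
    refine ⟨l.map e, by rwa [List.length_map], ?_⟩
    rw [hword, List.map_map, e.symm_comp_self, List.map_id]

end PBWBridge


/-! ### §2 The box `{0,…,L}^K` of multi-indices (a superset of `ℕ^K_{≤ L}`) -/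

section Box

variable {K L : ℕ}

/-- The box `{0,…,L}^K ⊇ ℕ^K_{≤L} = {i : |i| ≤ L}` of multi-indices used to index the table of the
circuit transformation (we use the cruder box, `(L+1)^K` points, in place of the printed
`|ℕ^K_{≤L}| = binom(L+K, K)`; same `O(L^K)`). [cite: BergEtAl2024, §5.2, p.28 (PDF p.29)] -/
abbrev Box (K L : ℕ) : Type := Fin K → Fin (L + 1)

/-- The multi-index `i ∈ ℕ^K` of a box point. [cite: BergEtAl2024, §5.2, p.28 (PDF p.29)] -/
def bval (c : Box K L) : Fin K → ℕ := fun r => (c r : ℕ)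

/-- Truncation of a multi-index into the box (the identity on `{0,…,L}^K`). [folklore] -/
def btrunc (L : ℕ) (i : Fin K → ℕ) : Box K L :=
  fun r => ⟨min (i r) L, Nat.lt_succ_of_le (Nat.min_le_right _ _)⟩

/-- `bval (btrunc i) = i` inside the box. [folklore] -/
private theorem bval_btrunc {i : Fin K → ℕ} (h : ∀ r, i r ≤ L) : bval (btrunc L i) = i :=
  funext fun r => Nat.min_eq_left (h r)

/-- Box points have entries `≤ L`. [folklore] -/
private theorem bval_le (c : Box K L) (r : Fin K) : bval c r ≤ L := Nat.le_of_lt_succ (c r).isLt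

/-- The box has `(L+1)^K` points. [cite: BergEtAl2024, §5.2 (proof of Thm. 5.10), p.29 (PDF p.30)] -/
theorem card_box : Fintype.card (Box K L) = (L + 1) ^ K := by
  rw [Fintype.card_fun, Fintype.card_fin, Fintype.card_fin]

/-- The lower set `{j : j ≤ i}` of a box point has at most `(L+1)^K` elements (the printed count of
the pairs `(i, i')`, `i' ≤ i`, is `|A| = binom(L+2K,2K)`; we use `(L+1)^{2K}`).
[cite: BergEtAl2024, §5.2 (proof of Thm. 5.10), p.29 (PDF p.30)] -/
theorem card_Iic_bval_le (c : Box K L) : (Iic (bval c)).card ≤ (L + 1) ^ K := by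
  rw [Pi.card_Iic]
  calc ∏ r, (Iic (bval c r)).card = ∏ r, (bval c r + 1) :=
        Finset.prod_congr rfl fun r _ => Nat.card_Iic _
    _ ≤ ∏ _r : Fin K, (L + 1) :=
        Finset.prod_le_prod (fun r _ => Nat.zero_le _) fun r _ => Nat.succ_le_succ (bval_le c r)
    _ = (L + 1) ^ K := by rw [Finset.prod_const, Finset.card_univ, Fintype.card_fin]

end Box

/-! ### §3 The step of the circuit transformation: one gate, all multi-indices (Lemma 5.9) -/

section Step

open Literature.Computability.AlgebraicComplexity ArithCircuit

variable {K L m : ℕ} {S : Type*} [CommRing S] [Algebra ℂ S]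

/-- **The step of [BDGIL24, proof of Thm. 5.10]**: the value `X^i.Θ` of a gate `Θ` of the circuit,
for every multi-index `i` in the box, as an expression in the values `X^{i'}.u` of its operands `u`
(`o u i'`): for an addition gate `Θ = Σ c_a u_a`, `X^i.Θ = Σ c_a X^i.u_a` (Lemma 5.9 (1)); for a
product gate `Θ = u₁ u₂`, `X^i.Θ = Σ_{i' ≤ i} binom(i,i') (X^{i'}.u₁)(X^{i−i'}.u₂)` (Lemma 5.9 (2));
empty product `1` (`X^i.1 = [i = 0]`), unary product `u`; gates of fan-in `> 2` (absent in the
tree's fan-in-two circuits) are sent to `0`.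
[cite: BergEtAl2024, Thm. 5.10 (proof, steps 2–3), p.29 (PDF p.30)] locator: paper:arxiv-2411.03444 p0030.txt:L4–L13 -/
def stepVal (o : Operand ℂ (Fin m) → Box K L → S) : Gate ℂ (Fin m) → Box K L → S
  | .sum args, c => (args.map fun a => a.1 • o a.2 c).sum
  | .prod [], c => if bval c = 0 then 1 else 0
  | .prod [u], c => o u c
  | .prod [u₁, u₂], c =>
      ∑ j ∈ Iic (bval c), ((∏ r, (bval c r).choose (j r) : ℕ) : ℂ) •
        (o u₁ (btrunc L j) * o u₂ (btrunc L (bval c - j)))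
  | .prod (_ :: _ :: _ :: _), _ => 0

/-- The step is natural in the coefficient algebra (it is a polynomial expression in the operand
values). [folklore] -/
private theorem map_stepVal {S' : Type*} [CommRing S'] [Algebra ℂ S'] (φ : S →ₐ[ℂ] S')
    (o : Operand ℂ (Fin m) → Box K L → S) (g : Gate ℂ (Fin m)) (c : Box K L) :
    φ (stepVal o g c) = stepVal (fun u c => φ (o u c)) g c := by
  match g with
  | .sum args =>
    simp only [stepVal, map_list_sum, List.map_map]
    congr 1
    exact List.map_congr_left fun a _ => by simp only [Function.comp_apply, map_smul]
  | .prod [] =>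
    simp only [stepVal]
    split_ifs
    · exact map_one φ
    · exact map_zero φ
  | .prod [u] => rfl
  | .prod [u₁, u₂] =>
    simp only [stepVal, map_sum, map_smul, map_mul]
  | .prod (_ :: _ :: _ :: _) => exact map_zero φ

/-- **Correctness of the step (Lemma 5.9)**: if the operand values are the true `X^{i'}.u`, for a
Leibniz family `X^•` (`X^i(ab) = Σ_{i'≤i} binom (X^{i'}a)(X^{i−i'}b)`, `X^i` kills constants for
`i ≠ 0`, `X^0 = id` on constants), then the step computes the true `X^i.Θ` for every gate `Θ` of
fan-in `≤ 2`. [cite: BergEtAl2024, Lemma 5.9 and Thm. 5.10 (proof), p.28–29 (PDF p.29–30)] -/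
theorem stepVal_truth {A' : Type*} [CommRing A'] [Algebra ℂ A']
    (Xop : (Fin K → ℕ) → Module.End ℂ A')
    (hleib : ∀ i a b, Xop i (a * b) =
      ∑ j ∈ Iic i, (∏ r, (i r).choose (j r)) • (Xop j a * Xop (i - j) b))
    (hconst : ∀ i (a : ℂ), Xop i (algebraMap ℂ A' a) = if i = 0 then algebraMap ℂ A' a else 0)
    (θ : MvPolynomial (Fin m) ℂ →ₐ[ℂ] A') (vals : List (MvPolynomial (Fin m) ℂ))
    (g : Gate ℂ (Fin m)) (hg : g.fanIn ≤ 2) (c : Box K L) :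
    stepVal (fun u c' => Xop (bval c') (θ (u.eval vals))) g c = Xop (bval c) (θ (g.eval vals)) := by
  match g with
  | .sum args =>
    simp only [stepVal, Gate.eval, map_list_sum, List.map_map]
    congr 1
    exact List.map_congr_left fun a _ => by simp only [Function.comp_apply, map_smul]
  | .prod [] =>
    simp only [stepVal, Gate.eval, List.map_nil, List.prod_nil]
    rw [← (algebraMap ℂ A').map_one, ← map_one (algebraMap ℂ (MvPolynomial (Fin m) ℂ)),
      AlgHom.commutes, hconst]
  | .prod [u] =>
    simp only [stepVal, Gate.eval, List.map_cons, List.map_nil, List.prod_cons, List.prod_nil, mul_one]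
  | .prod [u₁, u₂] =>
    simp only [stepVal, Gate.eval, List.map_cons, List.map_nil, List.prod_cons, List.prod_nil, mul_one,
      map_mul]
    rw [hleib]
    refine Finset.sum_congr rfl fun j hj => ?_
    have hjle : ∀ r, j r ≤ bval c r := fun r => (Finset.mem_Iic.1 hj) r
    rw [Nat.cast_smul_eq_nsmul, bval_btrunc fun r => (hjle r).trans (bval_le c r),
      bval_btrunc (i := bval c - j) fun r => (Nat.sub_le _ _).trans (bval_le c r)]
  | .prod (_ :: _ :: _ :: _) =>
    simp only [Gate.fanIn, Gate.args, List.length_cons] at hg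
    omega

end Step

/-! ### §4 A chain of substitutions with a final step (Bürgisser's sharing bound) -/

section Chain

open Literature.Computability.AlgebraicComplexity

variable {ν : Type*} {T : ℕ}

/-- The values of a chain of step polynomials `F_t ∈ ℂ[X_ν, Y_0, …, Y_{T−1}]`: `f_t := F_t(X, (f_s)_{s<t}, 0, …)`
(well-founded recursion on `t`). [cite: Burgisser2000, Rem. 2.7] -/
def chainVal (F : Fin T → MvPolynomial (ν ⊕ Fin T) ℂ) : Fin T → MvPolynomial ν ℂ
  | t => aeval (Sum.elim X fun s => if _h : s < t then chainVal F s else 0) (F t)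
  termination_by t => (t : ℕ)
  decreasing_by exact _h

/-- The defining recursion of `chainVal`. [cite: Burgisser2000, Rem. 2.7] -/
theorem chainVal_eq (F : Fin T → MvPolynomial (ν ⊕ Fin T) ℂ) (t : Fin T) :
    chainVal F t = aeval (Sum.elim X fun s => if s < t then chainVal F s else 0) (F t) := by
  rw [chainVal]
  simp only [dite_eq_ite]

/-- **Sharing bound with a final step**: a polynomial expression `G(X, f_0, …, f_{T−1})` in ALL the
values of a chain costs at most `Σ_t L(F_t) + L(G)` (the tree's `complexity_chain_le` applied to the
chain extended by `G`). [cite: Burgisser2000, Rem. 2.7] -/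
theorem complexity_aeval_chainVal_le (F : Fin T → MvPolynomial (ν ⊕ Fin T) ℂ)
    (G : MvPolynomial (ν ⊕ Fin T) ℂ) :
    complexity (aeval (Sum.elim X (chainVal F)) G) ≤ ∑ t, complexity (F t) + complexity G := by
  classical
  -- the extended chain
  let f' : Fin (T + 1) → MvPolynomial ν ℂ := Fin.snoc (chainVal F) (aeval (Sum.elim X (chainVal F)) G)
  let F' : Fin (T + 1) → MvPolynomial (ν ⊕ Fin (T + 1)) ℂ :=
    Fin.snoc (fun t => rename (Sum.map id Fin.castSucc) (F t)) (rename (Sum.map id Fin.castSucc) G)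
  have hF' : ∀ t : Fin (T + 1),
      f' t = aeval (Sum.elim X (fun s : Fin (T + 1) => if s < t then f' s else 0)) (F' t) := by
    intro t
    refine Fin.lastCases ?_ (fun t => ?_) t
    · simp only [f', F', Fin.snoc_last, aeval_rename, Sum.elim_comp_map, Function.comp_id]
      congr 2
      funext s
      rcases s with x | s
      · rfl
      · simp only [Sum.elim_inr, Function.comp_apply, if_pos (Fin.castSucc_lt_last s),
          Fin.snoc_castSucc]
    · simp only [f', F', Fin.snoc_castSucc, aeval_rename, Sum.elim_comp_map, Function.comp_id]
      rw [chainVal_eq]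
      congr 2
      funext s
      rcases s with x | s
      · rfl
      · simp only [Sum.elim_inr, Function.comp_apply, Fin.castSucc_lt_castSucc_iff,
          Fin.snoc_castSucc]
  have h := complexity_chain_le f' F' hF' (Fin.last T)
  simp only [f', F', Fin.snoc_last, Fin.sum_univ_castSucc, Fin.snoc_castSucc] at h
  refine h.trans (Nat.add_le_add (Finset.sum_le_sum fun t _ => complexity_rename_le_holds' _ _)
    (complexity_rename_le_holds' _ _))

end Chain

/-! ### §5 The circuit transformation ([BDGIL24, Thm. 5.10], abstract form) -/

section Transformation

open Literature.Computability.AlgebraicComplexity ArithCircuit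

variable {K L m : ℕ}

/-- The index of the table entry `X^i.Θ_j` (gate-major, so that the entries of earlier gates come
first). [cite: BergEtAl2024, Thm. 5.10 (proof), p.29 (PDF p.30)] -/
def tIdx (gs : List (Gate ℂ (Fin m))) (j : Fin gs.length) (c : Box K L) :
    Fin (gs.length * Fintype.card (Box K L)) :=
  finProdFinEquiv (j, Fintype.equivFin (Box K L) c)

/-- Earlier gates have smaller table indices. [folklore] -/
private theorem tIdx_lt_tIdx (gs : List (Gate ℂ (Fin m))) {j j' : Fin gs.length} (h : j' < j)
    (c c' : Box K L) : tIdx gs j' c' < tIdx gs j c := by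
  rw [Fin.lt_def]
  simp only [tIdx, finProdFinEquiv, Equiv.coe_fn_mk]
  have h1 := (Fintype.equivFin (Box K L) c').isLt
  have h2 : (j' : ℕ) + 1 ≤ j := h
  nlinarith [(Fintype.equivFin (Box K L) c).val.zero_le]

/-- **The syntactic operands of the step**: `X^{i}.u` for an operand `u` of gate number `j` — a NEW
input variable `x_{(v,i)}` (standing for the affine form `X^i.ℓ_v`) if `u` is the input `v`; the
constant `[i=0]·a` if `u` is the constant `a`; the table variable `Y_{(j',i)}` if `u` is an earlier
gate `j' < j` (junk references, `j' ≥ j`, read `0` as in the circuit semantics).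
[cite: BergEtAl2024, Thm. 5.10 (proof, step 1), p.29 (PDF p.30)] -/
def synOpnd (gs : List (Gate ℂ (Fin m))) (j : ℕ) :
    Operand ℂ (Fin m) → Box K L →
      MvPolynomial ((Fin m × Box K L) ⊕ Fin (gs.length * Fintype.card (Box K L))) ℂ
  | .var v, c => X (Sum.inl (v, c))
  | .const a, c => if bval c = 0 then C a else 0
  | .gate j', c => if h : j' < gs.length then
      (if j' < j then X (Sum.inr (tIdx gs ⟨j', h⟩ c)) else 0) else 0

/-- The step polynomials of the table: entry `(j, i)` is the step of gate `j` at multi-index `i`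
in the syntactic operands. [cite: BergEtAl2024, Thm. 5.10 (proof), p.29 (PDF p.30)] -/
def stepPoly (gs : List (Gate ℂ (Fin m))) (t : Fin (gs.length * Fintype.card (Box K L))) :
    MvPolynomial ((Fin m × Box K L) ⊕ Fin (gs.length * Fintype.card (Box K L))) ℂ :=
  stepVal (synOpnd gs (finProdFinEquiv.symm t).1) (gs.get (finProdFinEquiv.symm t).1)
    ((Fintype.equivFin (Box K L)).symm (finProdFinEquiv.symm t).2)

/-- The output combination `Σ_i β_i X^i.Δ` read off the table (`P = Σ_i β_i X^i` by PBW).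
[cite: BergEtAl2024, Thm. 5.10 (proof, step 4), p.29 (PDF p.30)] -/
def finalPoly (gs : List (Gate ℂ (Fin m))) (out : Operand ℂ (Fin m)) (β : Box K L → ℂ) :
    MvPolynomial ((Fin m × Box K L) ⊕ Fin (gs.length * Fintype.card (Box K L))) ℂ :=
  ∑ c, β c • synOpnd gs gs.length out c

/-- The step polynomial at the index of `(j, i)`. [folklore] -/
private theorem stepPoly_tIdx (gs : List (Gate ℂ (Fin m))) (j : Fin gs.length) (c : Box K L) :
    stepPoly gs (tIdx gs j c) = stepVal (synOpnd gs j) (gs.get j) c := by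
  simp only [stepPoly, tIdx, Equiv.symm_apply_apply]

/-! #### Semantics of the gate list (plumbing) -/

/-- The value list of a prefix is a prefix of the value list. [cite: Burgisser2000, Def. 2.1] -/
theorem getD_gateValues_take (gs : List (Gate ℂ (Fin m))) {j j' : ℕ} (hj' : j' < j)
    (hj : j ≤ gs.length) :
    (gateValues (gs.take j)).getD j' 0 = (gateValues gs).getD j' 0 := by
  obtain ⟨tl, htl⟩ := ArithCircuit.gateValues_prefix (k := ℂ) (gs.take j) (gs.drop j)
  rw [List.take_append_drop] at htl
  rw [htl, List.getD_eq_getElem?_getD, List.getD_eq_getElem?_getD,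
    List.getElem?_append_left (by rw [gateValues_length, List.length_take]; omega)]

/-- The value of gate `j` is its evaluation against the values of the earlier gates.
[cite: Burgisser2000, Def. 2.1] -/
theorem getD_gateValues_eq_eval (gs : List (Gate ℂ (Fin m))) (j : Fin gs.length) :
    (gateValues gs).getD j 0 = (gs.get j).eval (gateValues (gs.take j)) := by
  obtain ⟨tl, htl⟩ := ArithCircuit.gateValues_prefix (k := ℂ) (gs.take (j + 1)) (gs.drop (j + 1))
  rw [List.take_append_drop] at htl
  have htake : gs.take (j + 1) = gs.take j ++ [gs.get j] := by
    rw [List.take_succ_eq_append_getElem j.isLt]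
    rfl
  rw [htl, htake, gateValues_append_singleton, List.append_assoc, List.getD_eq_getElem?_getD,
    List.getElem?_append_right (by rw [gateValues_length, List.length_take]; omega),
    gateValues_length, List.length_take, Nat.min_eq_left (Nat.le_of_lt j.isLt), Nat.sub_self]
  rfl

/-- Junk references read `0`. [cite: Burgisser2000, Def. 2.1] -/
theorem getD_gateValues_take_of_le (gs : List (Gate ℂ (Fin m))) {j j' : ℕ} (hj' : j ≤ j') :
    (gateValues (gs.take j)).getD j' 0 = 0 := by
  rw [List.getD_eq_getElem?_getD, List.getElem?_eq_none (by
    rw [gateValues_length, List.length_take]; omega)]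
  rfl

/-! #### Correctness of the table -/

variable {A' : Type*} [CommRing A'] [Algebra ℂ A']

/-- The syntactic operands evaluate to the true `X^{i}.u` under any assignment that is correct on the
input variables and on the table variables of the earlier gates.
[cite: BergEtAl2024, Thm. 5.10 (proof), p.29 (PDF p.30)] -/
theorem aeval_synOpnd (Xop : (Fin K → ℕ) → Module.End ℂ A')
    (hconst : ∀ i (a : ℂ), Xop i (algebraMap ℂ A' a) = if i = 0 then algebraMap ℂ A' a else 0)
    (θ : MvPolynomial (Fin m) ℂ →ₐ[ℂ] A') (gs : List (Gate ℂ (Fin m))) {j : ℕ} (hj : j ≤ gs.length)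
    (ψ : (Fin m × Box K L) ⊕ Fin (gs.length * Fintype.card (Box K L)) → A')
    (hψl : ∀ v c, ψ (Sum.inl (v, c)) = Xop (bval c) (θ (X v)))
    (hψr : ∀ (j' : Fin gs.length) (c : Box K L), (j' : ℕ) < j →
      ψ (Sum.inr (tIdx gs j' c)) = Xop (bval c) (θ ((gateValues gs).getD j' 0)))
    (u : Operand ℂ (Fin m)) (c : Box K L) :
    aeval ψ (synOpnd gs j u c) = Xop (bval c) (θ (u.eval (gateValues (gs.take j)))) := by
  match u with
  | .var v => simp only [synOpnd, aeval_X, hψl, Operand.eval]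
  | .const a =>
    simp only [synOpnd, Operand.eval]
    have hθ : θ (C a) = algebraMap ℂ A' a := by
      rw [← MvPolynomial.algebraMap_eq]
      exact θ.commutes a
    rw [hθ, hconst]
    split_ifs with h
    · rw [aeval_C]
    · rw [map_zero]
  | .gate j' =>
    simp only [synOpnd, Operand.eval]
    by_cases h : j' < gs.length
    · rw [dif_pos h]
      by_cases hjj : j' < j
      · rw [if_pos hjj, aeval_X, hψr ⟨j', h⟩ c hjj, ← getD_gateValues_take gs hjj hj]
      · rw [if_neg hjj, map_zero, getD_gateValues_take_of_le gs (not_lt.1 hjj), map_zero, map_zero]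
    · rw [dif_neg h, map_zero, getD_gateValues_take_of_le gs (by omega), map_zero, map_zero]

/-- **Correctness of the table** (induction over the gates): under the affine substitution
`x_{(v,i)} ↦ X^i.ℓ_v`, the entry `(j, i)` of the chain is `X^i.(Θ_j(ℓ))`, `Θ_j` the value of gate `j`.
[cite: BergEtAl2024, Thm. 5.10 (proof, "The resulting circuit computes X^i.Δ"), p.29 (PDF p.30)] locator: paper:arxiv-2411.03444 p0030.txt:L14 -/
theorem aeval_chainVal_stepPoly (Xop : (Fin K → ℕ) → Module.End ℂ A')
    (hleib : ∀ i a b, Xop i (a * b) =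
      ∑ j ∈ Iic i, (∏ r, (i r).choose (j r)) • (Xop j a * Xop (i - j) b))
    (hconst : ∀ i (a : ℂ), Xop i (algebraMap ℂ A' a) = if i = 0 then algebraMap ℂ A' a else 0)
    (θ : MvPolynomial (Fin m) ℂ →ₐ[ℂ] A') (gs : List (Gate ℂ (Fin m)))
    (hfan : ∀ g ∈ gs, g.fanIn ≤ 2) (inp : Fin m × Box K L → A')
    (hinp : ∀ v c, inp (v, c) = Xop (bval c) (θ (X v))) (j : Fin gs.length) (c : Box K L) :
    aeval inp (chainVal (stepPoly gs) (tIdx gs j c)) =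
      Xop (bval c) (θ ((gateValues gs).getD j 0)) := by
  induction hn : (j : ℕ) using Nat.strong_induction_on generalizing j c with
  | _ n ih =>
    subst hn
    rw [chainVal_eq, stepPoly_tIdx, ← AlgHom.comp_apply, MvPolynomial.comp_aeval, map_stepVal]
    have hops : (fun u c' => aeval (fun x => aeval inp (Sum.elim X
        (fun s => if s < tIdx gs j c then chainVal (stepPoly gs) s else 0) x)) (synOpnd gs j u c')) =
        fun u c' => Xop (bval c') (θ (u.eval (gateValues (gs.take j)))) := by
      funext u c'
      refine aeval_synOpnd Xop hconst θ gs (Nat.le_of_lt j.isLt) _ (fun v c'' => ?_)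
        (fun j' c'' hj' => ?_) u c'
      · simp only [Sum.elim_inl, aeval_X, hinp]
      · simp only [Sum.elim_inr]
        rw [if_pos (tIdx_lt_tIdx gs hj' c c''), ih j' hj' j' c'' rfl]
    rw [hops, stepVal_truth Xop hleib hconst θ _ _ (hfan _ (List.get_mem gs j)) c,
      getD_gateValues_eq_eval]

/-- The output combination evaluates to `Σ_i β_i X^i.Δ`. [cite: BergEtAl2024, Thm. 5.10 (proof, step 4), p.29 (PDF p.30)] -/
theorem aeval_finalPoly (Xop : (Fin K → ℕ) → Module.End ℂ A')
    (hleib : ∀ i a b, Xop i (a * b) =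
      ∑ j ∈ Iic i, (∏ r, (i r).choose (j r)) • (Xop j a * Xop (i - j) b))
    (hconst : ∀ i (a : ℂ), Xop i (algebraMap ℂ A' a) = if i = 0 then algebraMap ℂ A' a else 0)
    (θ : MvPolynomial (Fin m) ℂ →ₐ[ℂ] A') (gs : List (Gate ℂ (Fin m)))
    (hfan : ∀ g ∈ gs, g.fanIn ≤ 2) (inp : Fin m × Box K L → A')
    (hinp : ∀ v c, inp (v, c) = Xop (bval c) (θ (X v))) (out : Operand ℂ (Fin m)) (β : Box K L → ℂ) :
    aeval inp (aeval (Sum.elim X (chainVal (stepPoly gs))) (finalPoly gs out β)) =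
      ∑ c, β c • Xop (bval c) (θ (out.eval (gateValues gs))) := by
  rw [← AlgHom.comp_apply, MvPolynomial.comp_aeval, finalPoly, map_sum]
  refine Finset.sum_congr rfl fun c _ => ?_
  rw [map_smul]
  congr 1
  have h := aeval_synOpnd Xop hconst θ gs le_rfl
    (fun x => aeval inp (Sum.elim X (chainVal (stepPoly gs)) x)) (fun v c' => ?_) (fun j' c' _ => ?_) out c
  · rwa [List.take_length] at h
  · simp only [Sum.elim_inl, aeval_X, hinp]
  · simp only [Sum.elim_inr]
    exact aeval_chainVal_stepPoly Xop hleib hconst θ gs hfan inp hinp j' c'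

/-! #### Cost of the table -/

/-- Operands are free (variables, constants). [cite: BergEtAl2024, §2.1, p.6 (PDF p.7)] -/
theorem complexity_synOpnd (gs : List (Gate ℂ (Fin m))) (j : ℕ) (u : Operand ℂ (Fin m)) (c : Box K L) :
    complexity (synOpnd gs j u c) = 0 := by
  have h0 : complexity (0 : MvPolynomial ((Fin m × Box K L) ⊕
      Fin (gs.length * Fintype.card (Box K L))) ℂ) = 0 := by
    rw [← C_0]; exact complexity_C_holds _
  match u with
  | .var v => exact complexity_X_holds _
  | .const a =>
    simp only [synOpnd]
    split_ifs
    · exact complexity_C_holds _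
    · exact h0
  | .gate j' =>
    simp only [synOpnd]
    split_ifs
    · exact complexity_X_holds _
    · exact h0
    · exact h0

/-- **Cost of one step**: `≤ 3 (L+1)^K` gates for a gate of fan-in `≤ 2` (one product, one scalar
and one addition per pair `i' ≤ i`; the printed count is `2|{i' ≤ i}| − 1`).
[cite: BergEtAl2024, Thm. 5.10 (proof, "The largest blow-up occurs in step 3"), p.29 (PDF p.30)] locator: paper:arxiv-2411.03444 p0030.txt:L19–L25 -/
theorem complexity_stepVal_synOpnd_le (gs : List (Gate ℂ (Fin m))) (j : ℕ) (g : Gate ℂ (Fin m))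
    (hg : g.fanIn ≤ 2) (c : Box K L) :
    complexity (stepVal (synOpnd gs j) g c) ≤ 3 * (L + 1) ^ K := by
  have hK : 1 ≤ (L + 1) ^ K := Nat.one_le_pow _ _ (Nat.succ_pos L)
  have h0 : complexity (0 : MvPolynomial ((Fin m × Box K L) ⊕
      Fin (gs.length * Fintype.card (Box K L))) ℂ) = 0 := by
    rw [← C_0]; exact complexity_C_holds _
  match g, hg with
  | .sum [], _ => simp only [stepVal, List.map_nil, List.sum_nil, h0]; omega
  | .sum [a], _ =>
    simp only [stepVal, List.map_cons, List.map_nil, List.sum_cons, List.sum_nil, add_zero]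
    refine (complexity_smul_le_holds _ _).trans ?_
    rw [complexity_synOpnd]; omega
  | .sum [a₁, a₂], _ =>
    simp only [stepVal, List.map_cons, List.map_nil, List.sum_cons, List.sum_nil, add_zero]
    refine (complexity_add_le_holds _ _).trans ?_
    have h1 := (complexity_smul_le_holds a₁.1 (synOpnd gs j a₁.2 c)).trans_eq
      (by rw [complexity_synOpnd])
    have h2 := (complexity_smul_le_holds a₂.1 (synOpnd gs j a₂.2 c)).trans_eq
      (by rw [complexity_synOpnd])
    omega
  | .sum (_ :: _ :: _ :: _), hg =>
    simp only [Gate.fanIn, Gate.args, List.map_cons, List.length_cons] at hg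
    omega
  | .prod [], _ =>
    simp only [stepVal]
    split_ifs
    · rw [← C_1, complexity_C_holds]; omega
    · rw [h0]; omega
  | .prod [u], _ => rw [stepVal, complexity_synOpnd]; omega
  | .prod [u₁, u₂], _ =>
    simp only [stepVal]
    refine (complexity_finset_sum_le _ _).trans ?_
    have hterm : ∀ j' ∈ Iic (bval c), complexity ((((∏ r, (bval c r).choose (j' r) : ℕ) : ℂ)) •
        (synOpnd gs j u₁ (btrunc L j') * synOpnd gs j u₂ (btrunc L (bval c - j')))) ≤ 2 := by
      intro j' _
      refine (complexity_smul_le_holds _ _).trans ?_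
      have h := complexity_mul_le_holds (synOpnd gs j u₁ (btrunc L j'))
        (synOpnd gs j u₂ (btrunc (K := K) L (bval c - j')))
      rw [complexity_synOpnd, complexity_synOpnd] at h
      omega
    have hcard := card_Iic_bval_le c
    calc ∑ j' ∈ Iic (bval c), complexity ((((∏ r, (bval c r).choose (j' r) : ℕ) : ℂ)) •
            (synOpnd gs j u₁ (btrunc L j') * synOpnd gs j u₂ (btrunc L (bval c - j')))) +
          (Iic (bval c)).card
        ≤ ∑ _j' ∈ Iic (bval c), 2 + (Iic (bval c)).card :=
          Nat.add_le_add_right (Finset.sum_le_sum hterm) _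
      _ = 3 * (Iic (bval c)).card := by rw [Finset.sum_const, smul_eq_mul]; ring
      _ ≤ 3 * (L + 1) ^ K := Nat.mul_le_mul_left 3 hcard
  | .prod (_ :: _ :: _ :: _), hg =>
    simp only [Gate.fanIn, Gate.args, List.length_cons] at hg
    omega

/-- Cost of the output combination: `≤ 2 (L+1)^K`. [cite: BergEtAl2024, Thm. 5.10 (proof, step 4), p.29 (PDF p.30)] -/
theorem complexity_finalPoly_le (gs : List (Gate ℂ (Fin m))) (out : Operand ℂ (Fin m))
    (β : Box K L → ℂ) : complexity (finalPoly gs out β) ≤ 2 * (L + 1) ^ K := by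
  rw [finalPoly]
  refine (complexity_finset_sum_le _ _).trans ?_
  have hterm : ∀ c ∈ (Finset.univ : Finset (Box K L)),
      complexity (β c • synOpnd gs gs.length out c) ≤ 1 := fun c _ =>
    (complexity_smul_le_holds _ _).trans (by rw [complexity_synOpnd])
  refine (Nat.add_le_add_right (Finset.sum_le_sum hterm) _).trans ?_
  rw [Finset.sum_const, smul_eq_mul, mul_one, Finset.card_univ, card_box]
  omega

/-! #### The abstract theorem -/

/-- **[BDGIL24, Thm. 5.10], abstract form.** Let `X^• = (X^i)_{i ∈ ℕ^K}` be a Leibniz family of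
linear operators on `ℂ[c_τ]` (`X^i(ab) = Σ_{i'≤i} binom(i,i')(X^{i'}a)(X^{i−i'}b)`, `X^i` kills the
constants for `i ≠ 0` and fixes them for `i = 0`) preserving the affine-linear polynomials (as the
ordered monomials in a basis of `gl_k` acting on metapolynomials do, Claim 4.2 / Lemma 5.9). Then
for every `Δ` with `cc(Δ) = s` and all scalars `β`,
`cc(Σ_{i ∈ {0..L}^K} β_i X^i.Δ) ≤ 5 (L+1)^{2K} · s` — the printed `O(s L^{2K})` (from
`≤ 3 (L+1)^{2K} s + 2 (L+1)^K` for `s ≥ 1`; for `s = 0` everything is affine and free; proof as printed: every gate `Θ` of an optimal circuit for `Δ` is replaced by the `(L+1)^K` table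
entries `X^i.Θ`, computed from the entries of its operands by Lemma 5.9 at cost `≤ 3(L+1)^K` each;
inputs `X^i.ℓ` of affine input gates `ℓ` are again affine input gates; one circuit computes the whole
table, `complexity_aeval_chainVal_le`).
[cite: BergEtAl2024, Thm. 5.10, p.29 (PDF p.30)] locator: paper:arxiv-2411.03444 p0030.txt:L1–L40 -/
theorem affComplexity_sum_smul_le_of_leibniz {τ : Type*} [Fintype τ]
    (Xop : (Fin K → ℕ) → Module.End ℂ (MvPolynomial τ ℂ))
    (hleib : ∀ i a b, Xop i (a * b) =
      ∑ j ∈ Iic i, (∏ r, (i r).choose (j r)) • (Xop j a * Xop (i - j) b))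
    (hconst : ∀ i (a : ℂ), Xop i (algebraMap ℂ (MvPolynomial τ ℂ) a) =
      if i = 0 then algebraMap ℂ (MvPolynomial τ ℂ) a else 0)
    (haff : ∀ i F, F.totalDegree ≤ 1 → (Xop i F).totalDegree ≤ 1)
    (L : ℕ) (β : Box K L → ℂ) (Δ : MvPolynomial τ ℂ) :
    affComplexity (∑ c, β c • Xop (bval c) Δ) ≤ 5 * (L + 1) ^ (2 * K) * affComplexity Δ := by
  classical
  -- `cc(Δ) = 0`: `Δ` is affine, hence so is every `X^i.Δ` and the combination is free
  rcases Nat.eq_zero_or_pos (affComplexity Δ) with hzero | hpos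
  · have hΔ : Δ.totalDegree ≤ 1 := totalDegree_le_one_of_affComplexity_eq_zero hzero
    have hsum : (∑ c, β c • Xop (bval c) Δ).totalDegree ≤ 1 :=
      totalDegree_finsetSum_le fun c _ => (totalDegree_smul_le _ _).trans (haff _ _ hΔ)
    rw [affComplexity_eq_zero_of_totalDegree_le_one hsum]
    exact Nat.zero_le _
  -- `cc(Δ) = s ≥ 1`: the table over an optimal circuit, `≤ 3 (L+1)^{2K} s + 2 (L+1)^K ≤ 5 (L+1)^{2K} s`
  suffices hadd : affComplexity (∑ c, β c • Xop (bval c) Δ) ≤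
      3 * (L + 1) ^ (2 * K) * affComplexity Δ + 2 * (L + 1) ^ K by
    refine hadd.trans ?_
    have hKK : (L + 1) ^ K ≤ (L + 1) ^ (2 * K) := Nat.pow_le_pow_right (Nat.succ_pos L) (by omega)
    nlinarith
  obtain ⟨m, G, ℓ, hℓ, hGΔ, hcG⟩ := exists_presentation_affComplexity Δ
  obtain ⟨P₀, hfan, hcomp, hsize⟩ := exists_computes_size_eq_complexity G
  -- the affine inputs of the new circuit and the new polynomial
  let inp : Fin m × Box K L → MvPolynomial τ ℂ := fun p => Xop (bval p.2) (ℓ p.1)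
  have hinp : ∀ v c, inp (v, c) = Xop (bval c) (aeval ℓ (X v : MvPolynomial (Fin m) ℂ)) :=
    fun v c => by simp only [inp, aeval_X]
  let Gfin : MvPolynomial (Fin m × Box K L) ℂ :=
    aeval (Sum.elim X (chainVal (stepPoly P₀.gates))) (finalPoly P₀.gates P₀.output β)
  have hval : aeval inp Gfin = ∑ c, β c • Xop (bval c) Δ := by
    have h := aeval_finalPoly Xop hleib hconst (aeval ℓ) P₀.gates hfan inp hinp P₀.output β
    rw [h]
    refine Finset.sum_congr rfl fun c _ => ?_
    rw [← hGΔ]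
    have hev : P₀.output.eval (gateValues P₀.gates) = G := hcomp
    rw [hev]
  -- presentation over `Fin m'`
  let e := Fintype.equivFin (Fin m × Box K L)
  have hpres : aeval (inp ∘ e.symm) (rename e Gfin) = ∑ c, β c • Xop (bval c) Δ := by
    rw [aeval_rename, Function.comp_assoc, e.symm_comp_self, Function.comp_id, hval]
  refine (affComplexity_le_of_presentation _ _ (fun i => haff _ _ (hℓ _)) hpres).trans ?_
  refine (complexity_rename_le_holds' _ _).trans ?_
  refine (complexity_aeval_chainVal_le _ _).trans ?_
  have hstep : ∀ t : Fin (P₀.gates.length * Fintype.card (Box K L)),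
      complexity (stepPoly P₀.gates t) ≤ 3 * (L + 1) ^ K := fun t =>
    complexity_stepVal_synOpnd_le _ _ _ (hfan _ (List.get_mem _ _)) _
  refine (Nat.add_le_add (Finset.sum_le_sum fun t _ => hstep t) (complexity_finalPoly_le _ _ _)).trans ?_
  rw [Finset.sum_const, Finset.card_univ, Fintype.card_fin, smul_eq_mul, card_box, ← hcG, ← hsize]
  have : P₀.gates.length = P₀.size := rfl
  have hpow : (L + 1) ^ (2 * K) = (L + 1) ^ K * (L + 1) ^ K := by rw [two_mul, pow_add]
  rw [this, hpow]
  exact le_of_eq (by ring)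

end Transformation

/-! ### §6 Ordered monomials of derivations mapping variables to affine forms (Claim 4.2) -/

section Affine

variable {τ : Type*} [Fintype τ]

/-- An exponent vector of degree `≤ 1` is `0` or a unit vector. [folklore] -/
private theorem finsupp_eq_zero_or_single'' {s : τ →₀ ℕ} (h : s.degree ≤ 1) :
    s = 0 ∨ ∃ i, s = Finsupp.single i 1 := by
  classical
  by_cases hs : s = 0
  · exact Or.inl hs
  · right
    obtain ⟨i, hi⟩ : ∃ i, s i ≠ 0 := by
      by_contra hall
      push Not at hall
      exact hs (Finsupp.ext hall)
    refine ⟨i, Finsupp.ext fun j => ?_⟩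
    have hsum : s.degree = ∑ j ∈ s.support, s j := rfl
    have hi' : i ∈ s.support := Finsupp.mem_support_iff.2 hi
    have hle : s i ≤ s.degree := by
      rw [hsum]
      exact Finset.single_le_sum (fun _ _ => Nat.zero_le _) hi'
    have hsi : s i = 1 := by omega
    by_cases hji : j = i
    · subst hji
      rw [Finsupp.single_eq_same, hsi]
    · rw [Finsupp.single_apply, if_neg (Ne.symm hji)]
      by_contra hj
      have hj' : j ∈ s.support := Finsupp.mem_support_iff.2 hj
      have h2 : s i + s j ≤ s.degree := by
        rw [hsum, ← Finset.sum_pair (Ne.symm hji)]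
        exact Finset.sum_le_sum_of_subset (by
          intro x hx
          rcases Finset.mem_insert.1 hx with rfl | hx
          · exact hi'
          · rw [Finset.mem_singleton.1 hx]; exact hj')
      omega

/-- Affine expansion: a polynomial of total degree `≤ 1` is `C (coeff 0 p) + Σᵢ C (coeff eᵢ p) · Xᵢ`.
[folklore] -/
private theorem eq_C_add_sum_of_totalDegree_le_one'' {p : MvPolynomial τ ℂ}
    (hp : p.totalDegree ≤ 1) :
    p = C (coeff 0 p) + ∑ i, C (coeff (Finsupp.single i 1) p) * X i := by
  classical
  ext s
  simp only [coeff_add, coeff_C, coeff_sum, coeff_C_mul, coeff_X]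
  by_cases hs0 : s = 0
  · subst hs0
    rw [if_pos rfl, Finset.sum_eq_zero (fun i _ => ?_), add_zero]
    rw [if_neg (Finsupp.single_ne_zero.mpr one_ne_zero), mul_zero]
  rw [if_neg (Ne.symm hs0), zero_add]
  by_cases hs1 : ∃ i, s = Finsupp.single i 1
  · obtain ⟨i, rfl⟩ := hs1
    rw [Finset.sum_eq_single i]
    · rw [if_pos rfl, mul_one]
    · intro j _ hji
      rw [if_neg (fun h => hji (Finsupp.single_left_injective one_ne_zero h)), mul_zero]
    · intro h; exact absurd (Finset.mem_univ i) h
  · have hl : coeff s p = 0 := by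
      by_contra h
      have hmem : s ∈ p.support := mem_support_iff.mpr h
      have hdeg : s.degree ≤ 1 := (le_totalDegree hmem).trans hp
      rcases finsupp_eq_zero_or_single'' hdeg with h | h
      · exact hs0 h
      · exact hs1 h
    rw [hl, eq_comm]
    refine Finset.sum_eq_zero fun i _ => ?_
    rw [if_neg (fun h => hs1 ⟨i, h.symm⟩), mul_zero]

/-- A derivation of `ℂ[c_τ]` mapping every variable to an affine-linear form (a "linear vector
field", as `gl_k` acting on metapolynomials by Claim 4.2) maps affine-linear forms to affine-linear
forms. [cite: BergEtAl2024, Claim 4.2 / §5.2, p.28 (PDF p.29)] -/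
theorem derivation_totalDegree_le_one (D : Derivation ℂ (MvPolynomial τ ℂ) (MvPolynomial τ ℂ))
    (hD : ∀ ν, (D (X ν)).totalDegree ≤ 1) {F : MvPolynomial τ ℂ} (hF : F.totalDegree ≤ 1) :
    (D F).totalDegree ≤ 1 := by
  classical
  have hC : ∀ c : ℂ, D (C c) = 0 := fun c => by
    rw [← MvPolynomial.algebraMap_eq]
    exact D.map_algebraMap c
  rw [eq_C_add_sum_of_totalDegree_le_one'' hF, map_add, hC, zero_add, map_sum]
  refine totalDegree_finsetSum_le fun i _ => ?_
  rw [D.leibniz, hC, smul_zero, add_zero, smul_eq_mul, MvPolynomial.C_mul']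
  exact (totalDegree_smul_le _ _).trans (hD i)

/-- Hence so do the ordered monomials `X^i` in such derivations: the inputs `X^i.ℓ` of the
transformed circuit are again affine input gates. [cite: BergEtAl2024, Thm. 5.10 (proof, step 1), p.29 (PDF p.30)] -/
theorem monOp_totalDegree_le_one {K : ℕ} (D : Fin K → Derivation ℂ (MvPolynomial τ ℂ) (MvPolynomial τ ℂ))
    (hD : ∀ r ν, (D r (X ν)).totalDegree ≤ 1) (i : Fin K → ℕ) {F : MvPolynomial τ ℂ}
    (hF : F.totalDegree ≤ 1) : (monOp D i F).totalDegree ≤ 1 := by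
  induction K generalizing F with
  | zero => rw [Subsingleton.elim i 0, monOp_zero, Module.End.one_apply]; exact hF
  | succ K ih =>
    unfold monOp
    rw [List.ofFn_succ, List.prod_cons, Module.End.mul_apply]
    have htail := ih (fun r => D r.succ) (fun r ν => hD r.succ ν) (fun r => i r.succ) hF
    unfold monOp at htail
    have hpow : ∀ (n : ℕ) (G : MvPolynomial τ ℂ), G.totalDegree ≤ 1 →
        ((((D 0 : Derivation ℂ _ _) : Module.End ℂ (MvPolynomial τ ℂ)) ^ n) G).totalDegree ≤ 1 := by
      intro n
      induction n with
      | zero => intro G hG; rwa [pow_zero, Module.End.one_apply]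
      | succ n ihn =>
        intro G hG
        rw [pow_succ, Module.End.mul_apply]
        exact ihn _ (derivation_totalDegree_le_one (D 0) (hD 0) hG)
    exact hpow _ _ htail

/-- **[BDGIL24, Thm. 5.10] for ordered monomials in derivations**: for derivations `D₀,…,D_{K−1}`
of `ℂ[c_τ]` mapping variables to affine forms and all scalars `β`,
`cc(Σ_{i ∈ {0..L}^K} β_i X^i.Δ) ≤ 5 (L+1)^{2K} cc(Δ)` (`X^i = monOp D i`).
[cite: BergEtAl2024, Thm. 5.10, p.29 (PDF p.30)] locator: paper:arxiv-2411.03444 p0030.txt:L1–L40 -/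
theorem affComplexity_sum_smul_monOp_le {K : ℕ}
    (D : Fin K → Derivation ℂ (MvPolynomial τ ℂ) (MvPolynomial τ ℂ))
    (hD : ∀ r ν, (D r (X ν)).totalDegree ≤ 1) (L : ℕ) (β : Box K L → ℂ) (Δ : MvPolynomial τ ℂ) :
    affComplexity (∑ c, β c • monOp D (bval c) Δ) ≤ 5 * (L + 1) ^ (2 * K) * affComplexity Δ :=
  affComplexity_sum_smul_le_of_leibniz (monOp D) (monOp_mul D) (monOp_algebraMap D)
    (fun i _ hF => monOp_totalDegree_le_one D hD i hF) L β Δ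

end Affine

/-! ### §7 [BDGIL24, Thm. 5.10] in `U(gl_k)`: length `L` ⇒ size `O(s · L^{2k²})` -/

section Thm510

open Literature.Computability.AlgebraicComplexity Literature.NumberTheory.DiophantineGeometry
open Literature.Algebra.Lie.PBW Literature.Algebra.Lie.ChevalleyGL UniversalEnvelopingAlgebra
open Literature.NumberTheory.Automorphic.HCCore (stdB)

-- the PBW order on the index type `Idx T k = T × Fin k × Fin k` of the standard basis `stdB`
-- (`𝔫⁻ < 𝔥 < 𝔫⁺`), registered locally exactly as in `HarishChandraCore` (the length filtration
-- `Literature.Algebra.Lie.PBW.fil` takes the order as an instance)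
attribute [local instance] Literature.NumberTheory.Automorphic.HCCore.idxLinearOrder

variable {k d : ℕ} {T : Type*} [Fintype T] [DecidableEq T] (τ₀ : T)

omit [Fintype T] [DecidableEq T] in
/-- The generators `E_{ab}` of `gl_k` act on metapolynomials by linear vector fields: `lieOp N`
maps every metavariable `c_ν` to a linear form (Claim 4.2). [cite: BergEtAl2024, Claim 4.2, p.13 (PDF p.14)] -/
theorem totalDegree_lieOp_X_le_one (N : Matrix (Fin k) (Fin k) ℂ) (ν : DegIdx (Fin k) d) :
    (lieOp k d N (X ν)).totalDegree ≤ 1 := by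
  rw [lieOp_X, totalDegree_neg]
  exact totalDegree_sum_smul_X_le_one _ _ _

omit [DecidableEq T] in
/-- The PBW ordered monomial `x_s` of the (reindexed) standard basis acts on metapolynomials through
the block `τ₀` as the ordered monomial `X^s` in the derivations `lieOp E_{e⁻¹(r)}` (`monOp`).
[cite: BergEtAl2024, Thm. 4.9 / Claim 4.2 / §5.2, p.19 and p.28 (PDF p.20, p.29)] -/
theorem envActGL_ordMonomial_reindex_apply {K : ℕ} (e : Idx T k ≃ Fin K) (s : Fin K →₀ ℕ)
    (Δ : MvPolynomial (DegIdx (Fin k) d) ℂ) :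
    envActGL k d τ₀ (ordMonomial ((stdB T k).reindex e) s) Δ =
      monOp (fun r => lieOp k d (stdB T k (e.symm r) τ₀)) (⇑s) Δ := by
  rw [ordMonomial_eq_prod_ofFn_pow, map_list_prod, List.map_ofFn, monOp]
  congr 2
  refine congrArg List.ofFn (funext fun r => ?_)
  rw [Function.comp_apply, map_pow, envActGL_ι, Module.Basis.reindex_apply]

/-- **Theorem 5.10 of [BDGIL24], as printed (with an explicit constant).** "Let `P ∈ U(gl_k)` be an
element of length `L`. Suppose there exists an arithmetic circuit `C` of size `s` computing a
metapolynomial `Δ : ℂ[x₁,…,x_k]_d → ℂ`. Then there exists an arithmetic circuit `C′` of size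
`O(s L^{2k²})` computing `P.Δ`." Typed in the block model `U(T → gl_k)` acting through the block `τ₀`
(`envActGL`, the tree's `U(gl_k)`-action on metapolynomials; `T` a one-element type is `U(gl_k)`
verbatim), with length = the PBW filtration `fil (stdB T k) L` (§4.3) and size = `cc = affComplexity`
(circuits with affine input gates, §2.1): `cc(P.Δ) ≤ 5 (L+1)^{2K} · cc(Δ)`,
`K = |T| k²` (`= k²` for one block: `O(s · L^{2k²})` as printed; the printed proof's count
`2|A| − 1` per gate, `|A| = binom(L+2K, 2K)`, is replaced by the cruder `3 (L+1)^{2K}` (plus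
`2(L+1)^K ≤ 2(L+1)^{2K} s` for the final combination), same `O`). Proof as
printed: PBW (Thm. 4.9: `P = Σ_{|i| ≤ L} β_i X^i`, the tree's `pbwBasis` / `mem_fil_iff_repr`), the
table `X^i.Θ` over the gates `Θ` of an optimal circuit (Lemma 5.9, `affComplexity_sum_smul_monOp_le`).
The tree also holds the length-free bound `cc(P.Δ) ≤ (δd+1)^{k²−1}(s+2)` for homogeneous `Δ`
(`affComplexity_envAct_apply_le`, orbit span), sharper when `L ≫ δd`.
[cite: BergEtAl2024, Thm. 5.10, p.29 (PDF p.30)] locator: paper:arxiv-2411.03444 p0030.txt:L1–L40 -/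
theorem thm_5_10 {L : ℕ} {P : UniversalEnvelopingAlgebra ℂ (T → Matrix (Fin k) (Fin k) ℂ)}
    (hP : P ∈ fil (stdB T k) L) (Δ : MvPolynomial (DegIdx (Fin k) d) ℂ) :
    affComplexity (envActGL k d τ₀ P Δ) ≤
      5 * (L + 1) ^ (2 * Fintype.card (Idx T k)) * affComplexity Δ := by
  classical
  -- reindex the standard basis by `Fin K`
  let e : Idx T k ≃ Fin (Fintype.card (Idx T k)) := Fintype.equivFin _
  have hP' : P ∈ fil ((stdB T k).reindex e) L := by rw [fil_reindex]; exact hP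
  let D : Fin (Fintype.card (Idx T k)) →
      Derivation ℂ (MvPolynomial (DegIdx (Fin k) d) ℂ) (MvPolynomial (DegIdx (Fin k) d) ℂ) :=
    fun r => lieOp k d (stdB T k (e.symm r) τ₀)
  have hD : ∀ r ν, (D r (X ν)).totalDegree ≤ 1 := fun r ν => totalDegree_lieOp_X_le_one _ _
  -- PBW expansion of `P` (Thm. 4.9): `P = Σ_s ρ_s x_s`, `deg s ≤ L` on the support
  set ρ := (pbwBasis ((stdB T k).reindex e)).repr P with hρ
  let φ : Box (Fintype.card (Idx T k)) L → (Fin (Fintype.card (Idx T k)) →₀ ℕ) :=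
    fun c => Finsupp.equivFunOnFinite.symm (bval c)
  have hφ : Function.Injective φ := fun c c' h => by
    have h' : bval c = bval c' := by
      have := congrArg (fun f : Fin (Fintype.card (Idx T k)) →₀ ℕ => (⇑f : _ → ℕ)) h
      simpa [φ] using this
    funext r
    exact Fin.ext (congr_fun h' r)
  have hPsum : P = ∑ s ∈ ρ.support, ρ s • ordMonomial ((stdB T k).reindex e) s := by
    conv_lhs => rw [← (pbwBasis ((stdB T k).reindex e)).linearCombination_repr P,
      Finsupp.linearCombination_apply]
    simp only [pbwBasis_apply]
    rfl
  have hexp : envActGL k d τ₀ P Δ = ∑ c, ρ (φ c) • monOp D (bval c) Δ := by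
    have h1 : envActGL k d τ₀ P Δ = ∑ s ∈ ρ.support, ρ s • monOp D (⇑s) Δ := by
      conv_lhs => rw [hPsum]
      rw [map_sum, LinearMap.sum_apply]
      refine Finset.sum_congr rfl fun s _ => ?_
      rw [map_smul, LinearMap.smul_apply, envActGL_ordMonomial_reindex_apply]
    rw [h1]
    -- reindex the sum by the box: the support consists of multi-indices with entries `≤ L`
    have hsub : ρ.support ⊆ Finset.univ.map ⟨φ, hφ⟩ := by
      intro s hs
      have hdeg : s.degree ≤ L := (mem_fil_iff_repr _).1 hP' s (Finsupp.mem_support_iff.1 hs)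
      refine Finset.mem_map.2 ⟨fun r => ⟨s r, Nat.lt_succ_of_le ((Finsupp.le_degree r s).trans hdeg)⟩,
        Finset.mem_univ _, ?_⟩
      ext r
      simp [φ, bval]
    rw [Finset.sum_subset hsub (fun s _ hs => by
      rw [Finsupp.notMem_support_iff.1 hs, zero_smul]), Finset.sum_map]
    refine Finset.sum_congr rfl fun c _ => ?_
    simp only [Function.Embedding.coeFn_mk, φ, Finsupp.coe_equivFunOnFinite_symm]
  rw [hexp]
  exact affComplexity_sum_smul_monOp_le D hD L _ Δ

omit [DecidableEq T] in
/-- `|Idx T k| = |T| · k²`. [folklore] -/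
private theorem card_idx : Fintype.card (Idx T k) = Fintype.card T * k ^ 2 := by
  rw [Fintype.card_prod, Fintype.card_prod, Fintype.card_fin, sq]

/-- **Theorem 5.10 for one block (`U(gl_k)` verbatim): `cc(P.Δ) ≤ 5 (L+1)^{2k²} · cc(Δ) = O(s · L^{2k²})`.**
[cite: BergEtAl2024, Thm. 5.10, p.29 (PDF p.30)] locator: paper:arxiv-2411.03444 p0030.txt:L1–L3 -/
theorem thm_5_10_oneBlock (hT : Fintype.card T = 1) {L : ℕ}
    {P : UniversalEnvelopingAlgebra ℂ (T → Matrix (Fin k) (Fin k) ℂ)} (hP : P ∈ fil (stdB T k) L)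
    (Δ : MvPolynomial (DegIdx (Fin k) d) ℂ) :
    affComplexity (envActGL k d τ₀ P Δ) ≤ 5 * (L + 1) ^ (2 * k ^ 2) * affComplexity Δ := by
  have h := thm_5_10 τ₀ hP Δ
  rwa [card_idx, hT, one_mul] at h

end Thm510

/-! ### §8 The printed proof of Theorem 1.1 (end of §5.2): the length bounds of Cor. 5.5–5.8 fed
into Thm. 5.10 -/

section ProofOfThm11

open Literature.Computability.AlgebraicComplexity Literature.NumberTheory.DiophantineGeometry
open Literature.Algebra.Lie.PBW Literature.Algebra.Lie.ChevalleyGL UniversalEnvelopingAlgebra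
open Literature.NumberTheory.Automorphic.HCCore (stdB)

attribute [local instance] Literature.NumberTheory.Automorphic.HCCore.idxLinearOrder

variable {k d : ℕ} {T : Type*} [Fintype T] [DecidableEq T] (τ₀ : T)

omit [Fintype T] [DecidableEq T] in
/-- The block type `T₀ = (ℝ →ₐ[ℝ] ℂ)` of the Cor. 5.6–5.8 files has one element
(`uniqueOfSubsingleton (Algebra.ofId ℝ ℂ)`, as in `card_casimirIndex`). [folklore] -/
private theorem card_algHom_real_complex : Fintype.card (ℝ →ₐ[ℝ] ℂ) = 1 := by
  haveI : Unique (ℝ →ₐ[ℝ] ℂ) := uniqueOfSubsingleton (Algebra.ofId ℝ ℂ)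
  exact Fintype.card_unique

/-- **Proof of Theorem 1.1, item 1, as printed**: "For every weight `μ`, Corollary 5.5 provides an
element `H_μ ∈ U(gl_k)` of length at most `O((δd)^k)` acting as projection on the weight space of
weight `μ`. Theorem 5.10 guarantees that `H_μ.Δ` admits a circuit of size at most
`O(s((δd)^k)^{2k²}) = O(s(δd)^{2k³})`." — `cor_5_5_length` + `thm_5_10`, explicit constant
`5 ((δd+1)^k + 1)^{2K}`, `K = |T| k²` (`= k²` for one block). The tree's `thm_1_1_weight_holds` has
the sharper orbit-span bound; this is the printed route.
[cite: BergEtAl2024, §5.2 "Proof of Theorem 1.1" item 1, p.29 (PDF p.30)] locator: paper:arxiv-2411.03444 p0030.txt:L86–L91 -/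
theorem thm_1_1_proof_weight (k d δ : ℕ) (χ : Weight (Fin k)) :
    ∃ H : UniversalEnvelopingAlgebra ℂ (T → Matrix (Fin k) (Fin k) ℂ),
      (∀ Δ : MvPolynomial (DegIdx (Fin k) d) ℂ, Δ.IsHomogeneous δ →
          envActGL k d τ₀ H Δ = weightedHomogeneousComponent
            (fun ν : DegIdx (Fin k) d => (fun i : Fin k => -((ν.1 i : ℕ) : ℤ))) χ Δ) ∧
        ∀ Δ : MvPolynomial (DegIdx (Fin k) d) ℂ,
          affComplexity (envActGL k d τ₀ H Δ) ≤
            5 * ((δ * d + 1) ^ k + 1) ^ (2 * Fintype.card (Idx T k)) * affComplexity Δ := by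
  obtain ⟨H, hHfil, hH⟩ := cor_5_5_length τ₀ k d δ χ
  exact ⟨H, hH, fun Δ => thm_5_10 τ₀ hHfil Δ⟩

/-- **Proof of Theorem 1.1, item 2, as printed**: "For every partition `λ`, Corollary 5.6 provides an
element `Z_λ ∈ U(gl_k)` of length at most `O(k(δd)^k)` acting as projection on the isotypic
component of type `λ`. Theorem 5.10 guarantees that `Z_λ.Δ` admits a circuit of size at most
`O(s(k(δd)^k)^{2k²}) = O(s k^{2k²} (δd)^{2k³})`." — `cor_5_6_length` + `thm_5_10_oneBlock`,
explicit constant `5 (k(δd+1)^k + 1)^{2k²}`.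
[cite: BergEtAl2024, §5.2 "Proof of Theorem 1.1" item 2, p.29 (PDF p.30)] locator: paper:arxiv-2411.03444 p0030.txt:L92–L95 -/
theorem thm_1_1_proof_isotypic [DecidableEq (ℝ →ₐ[ℝ] ℂ)] (τ₀ : ℝ →ₐ[ℝ] ℂ) (δ : ℕ)
    (χ : Weight (Fin k)) :
    ∃ Z : UniversalEnvelopingAlgebra ℂ ((ℝ →ₐ[ℝ] ℂ) → Matrix (Fin k) (Fin k) ℂ),
      (∀ Δ : MvPolynomial (DegIdx (Fin k) d) ℂ, Δ.IsHomogeneous δ →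
          envActGL k d τ₀ Z Δ ∈ hwSubrep (coordRep (Fin k) ℂ d) χ ∧
            Δ - envActGL k d τ₀ Z Δ ∈
              ⨆ χ' ∈ {χ' : Weight (Fin k) | χ' ≠ χ}, hwSubrep (coordRep (Fin k) ℂ d) χ') ∧
        ∀ Δ : MvPolynomial (DegIdx (Fin k) d) ℂ,
          affComplexity (envActGL k d τ₀ Z Δ) ≤
            5 * (k * (δ * d + 1) ^ k + 1) ^ (2 * k ^ 2) * affComplexity Δ := by
  obtain ⟨Z, hZfil, hZ⟩ := cor_5_6_length (d := d) τ₀ δ χ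
  exact ⟨Z, hZ, fun Δ => thm_5_10_oneBlock τ₀ card_algHom_real_complex hZfil Δ⟩

/-- **Proof of Theorem 1.1, item 3, as printed**: "For every partition `λ`, Corollary 5.7 provides
an element `X_λ ∈ U(gl_k)` of length at most `O((k+1)(δd)^k)` acting as projection on the highest
weight space of weight `λ`. Theorem 5.10 guarantees that `X_λ.Δ` admits a circuit of size at most
`O(s((k+1)(δd)^k)^{2k²}) = O(s(k+1)^{2k²}(δd)^{2k³})`." — `cor_5_7_length` + `thm_5_10_oneBlock`,
explicit constant `5 ((k+1)(δd+1)^k + 1)^{2k²}`.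
[cite: BergEtAl2024, §5.2 "Proof of Theorem 1.1" item 3, p.30 (PDF p.31)] locator: paper:arxiv-2411.03444 p0031.txt:L1–L5 -/
theorem thm_1_1_proof_hwv [DecidableEq (ℝ →ₐ[ℝ] ℂ)] (τ₀ : ℝ →ₐ[ℝ] ℂ) (δ : ℕ) (χ : Weight (Fin k)) :
    ∃ X : UniversalEnvelopingAlgebra ℂ ((ℝ →ₐ[ℝ] ℂ) → Matrix (Fin k) (Fin k) ℂ),
      (∀ Δ : MvPolynomial (DegIdx (Fin k) d) ℂ, Δ.IsHomogeneous δ →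
          envActGL k d τ₀ X Δ ∈ highestWeightSpace (coordRep (Fin k) ℂ d) χ ∧
            Δ - envActGL k d τ₀ X Δ ∈
              (⨆ χ' ∈ {χ' : Weight (Fin k) | χ' ≠ χ}, hwSubrep (coordRep (Fin k) ℂ d) χ') ⊔
                (⨆ χ' ∈ {χ' : Weight (Fin k) | χ' ≠ χ}, weightSpace (coordRep (Fin k) ℂ d) χ')) ∧
        ∀ Δ : MvPolynomial (DegIdx (Fin k) d) ℂ,
          affComplexity (envActGL k d τ₀ X Δ) ≤
            5 * ((k + 1) * (δ * d + 1) ^ k + 1) ^ (2 * k ^ 2) * affComplexity Δ := by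
  obtain ⟨X, hXfil, hX⟩ := cor_5_7_length (d := d) τ₀ δ χ
  exact ⟨X, hX, fun Δ => thm_5_10_oneBlock τ₀ card_algHom_real_complex hXfil Δ⟩

/-- **Proof of Theorem 1.1, item 4, as printed**: "For every semistandard tableau `T` of shape
`λ ⊢ dδ`, Corollary 5.8 provides an element `Y_λ ∈ U(gl_k)` of length at most `O(k(δd)^{k²})` acting
as projection on the `T`-isotypic space. Theorem 5.10 guarantees that `Y_T.Δ` admits a circuit of
size at most `O(s(k(δd)^{k²})^{2k²}) = O(s k^{2k²}(δd)^{2k⁴})`." — `cor_5_8_length` +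
`thm_5_10_oneBlock`, explicit constant `5 (k(δd+1)^{k²} + 1)^{2k²}`.
[cite: BergEtAl2024, §5.2 "Proof of Theorem 1.1" item 4, p.30 (PDF p.31)] locator: paper:arxiv-2411.03444 p0031.txt:L6–L12 -/
theorem thm_1_1_proof_gt [DecidableEq (ℝ →ₐ[ℝ] ℂ)] (τ₀ : ℝ →ₐ[ℝ] ℂ) (δ : ℕ) (P : GTPattern k) :
    ∃ Y : UniversalEnvelopingAlgebra ℂ ((ℝ →ₐ[ℝ] ℂ) → Matrix (Fin k) (Fin k) ℂ),
      (∀ Δ : MvPolynomial (DegIdx (Fin k) d) ℂ, Δ.IsHomogeneous δ →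
          envActGL k d τ₀ Y Δ ∈ gtSubspace (coordRep (Fin k) ℂ d) P ∧
            Δ - envActGL k d τ₀ Y Δ ∈
              ⨆ P' ∈ {P' : GTPattern k | P' ≠ P}, gtSubspace (coordRep (Fin k) ℂ d) P') ∧
        ∀ Δ : MvPolynomial (DegIdx (Fin k) d) ℂ,
          affComplexity (envActGL k d τ₀ Y Δ) ≤
            5 * (k * (δ * d + 1) ^ (k ^ 2) + 1) ^ (2 * k ^ 2) * affComplexity Δ := by
  obtain ⟨Y, hYfil, hY⟩ := cor_5_8_length (d := d) τ₀ δ P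
  exact ⟨Y, hY, fun Δ => thm_5_10_oneBlock τ₀ card_algHom_real_complex hYfil Δ⟩

end ProofOfThm11
end BergEtAl2024

end Literature.Barriers.ValiantsHypothesis
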